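import Literature.NumberTheory.LFunctions.MontgomeryVaughanLogMeansProofs
import Literature.Analysis.Fourier.AbsSinFourierSeries
import HarnessLib

/-!
# Proof of Montgomery–Vaughan 2001, Lemma 2: `F(σ+it)/F(σ) ≪ (1 + |t|/(σ−1))^{4/π}`, `≪ (log|t|/(σ−1))^{4/π}`

Proofs only (no definitions, no named facts), companion of `MontgomeryVaughanLogMeans.lean` and
`MontgomeryVaughanLogMeansProofs.lean`. DISCHARGES the named fact
`Literature.NumberTheory.LFunctions.MontgomeryVaughan2001_lemma2` (H. L. Montgomery, R. C. Vaughan,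
*Mean values of multiplicative functions*, Period. Math. Hungar. 43 (2001), Lemma 2, p. 209): for `f`
totally multiplicative with `|f(n)| ≤ 1`, `F(s) = Σ f(n)n^{-s}`, `1 < σ ≤ 2`:
`|F(σ+it)| ≤ C(1 + |t|/(σ−1))^{4/π}|F(σ)|` for `|t| ≤ 2` and `|F(σ+it)| ≤ C(log|t|/(σ−1))^{4/π}|F(σ)|`
for `|t| ≥ 2`, one absolute `C` — as `MontgomeryVaughan2001_lemma2_holds`.

## The argument, as formalised

* (20) of the source, proved in `MontgomeryVaughanLogMeansProofs.lean`
  (`MontgomeryVaughan2001.norm_LSeries_shift_le`): `|F(σ+it)| ≤ e⁴ exp(S)|F(σ)|`,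
  `S = Σ_p p^{-σ}|p^{-it} − 1| = 2Σ_p p^{-σ}|sin(½ t log p)|` (`norm_natCast_cpow_neg_mul_I_sub_one_eq`).
* The Fourier series of `|sin|` (the tree's `Literature.Analysis.Fourier.hasSum_abs_sin_nat`,
  `2/π − |sin θ| = Σ_{m≥0} a_m cos(2(m+1)θ)`, `a_m = 4/(π(4(m+1)²−1)) > 0`, `Σ a_m = 2/π`) at
  `θ = ½ t log p`, summed against `p^{-σ}`; the double series converges absolutely, so
  (`hasSum_absSinCoeff_mul_cosSum`, `tsum_primes_rpow_mul_abs_sin_eq`)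
  `Σ_p p^{-σ}|sin(½t log p)| = (2/π)P(σ) − Σ_m a_m C_m`, `P(σ) = Σ_p p^{-σ}`,
  `C_m = Σ_p p^{-σ}cos((m+1)t log p) = Re Σ_p p^{-σ-i(m+1)t}`.
* `|log|ζ(σ+iu)| − Σ_p p^{-σ}cos(u log p)| ≤ Σ_p p^{-2} ≤ 2` (`abs_log_norm_zeta_sub_cosSum_le`, the
  Euler product in exponential form for the trivial twist, machinery of the Lemma 1 file); hence
  `P(σ) ≤ log(2/(σ−1)) + 2` (`primeZeta_le`) and `−C_m ≤ 2 + log|1/ζ(σ + i(m+1)t)|`.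
* `1/ζ` to the right of `1` (`exists_log_norm_inv_zeta_le`, from the tree's
  `ZetaClassicalRegion.exists_zeroFreeRegion_bounds` = Titchmarsh (3.11.8), the source's
  "`|ζ(σ+it)| ≥ 1/(C log t)`"): `log|1/ζ(σ+iu)| ≤ log log(|u|+3) + B`, and near the pole also
  `≤ log((σ−1)+|u|) + log log(|u|+3) + B` (from `‖ζ(s) − 1/(s−1)‖ ≪ log(|u|+3)`).
* Summing against `a_m` (`tsum_absSinCoeff_mul_le`, with `Σ_m a_m log(m+1) < ∞`,
  `summable_absSinCoeff_mul_log`) with the exact total `Σ a_m = 2/π`: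
  `Σ_p p^{-σ}|sin(½t log p)| ≤ (2/π)log(log|t|/(σ−1)) + O(1)` for `|t| ≥ 2`
  (`tsum_abs_sin_le_of_two_le`), and `≤ (2/π)log(|t|/(σ−1)) + O(1)` for `σ−1 ≤ |t| ≤ 2`
  (`tsum_abs_sin_le_of_le_two`); exponentiating (factor `2`) gives the exponent `4/π`.
* The range `|t| ≤ σ − 1` (`|F(σ+it)| ≍ |F(σ)|`) is the tree's
  `MontgomeryVaughan2001.exists_norm_LSeries_shift_le_of_abs_le`.

Deviation from the printed proof: the source (and Roy–Vatwani, Lemma 7.2, which for `k = 1` "recovers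
Lemmas 1 and 2 of [MontgomeryVaughan2001]") treats `σ − 1 ≤ |t| ≤ 2` by Mertens' theorem and partial
summation against `|sin|` (`∫₀^y |sin u| du = (2/π)y + O(1)`); here that range is handled by the same
Fourier expansion as `|t| ≥ 2`, using `|ζ(s)| ≥ 1/(2|s−1|)` for `|s − 1| log(|t|+3) ≪ 1`. The statement
proved is the vendored one, unchanged.

Axioms: `propext`, `Classical.choice`, `Quot.sound` only.

## References

* [MontgomeryVaughan2001] H. L. Montgomery, R. C. Vaughan, *Mean values of multiplicative functions*,
  Period. Math. Hungar. 43 (2001), 199–214, Lemma 2 (p. 209) and its proof, (20) (not held here: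
  paywalled, doi:10.1023/a:1015202219630; statement as vendored in `MontgomeryVaughanLogMeans.lean`).
* [RoyVatwani2019] A. Roy, A. Vatwani, *Zeros of partial sums of L-functions*, Adv. Math. 346 (2019),
  Lemma 7.2 and its proof (arXiv:1807.11093, p. 16; read): the same statement with exponent `4k/π`
  for `f ∈ 𝒞(k)`, `k = 1` being Montgomery–Vaughan's Lemma 2; the Fourier-series device and
  "`|ζ(s)| ≥ 1/(C log|t|)` uniformly for `σ > 1`, `|t| ≥ 2`".
-/

noncomputable section

open Complex Filter
open scoped Topology

namespace Literature.NumberTheory.LFunctions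

namespace MontgomeryVaughan2001

/-! ## The chord `|p^{-it} − 1| = 2|sin(½ t log p)|` -/

/-- `p^{-iu} = e^{-iu log p}`. [folklore] -/
theorem natCast_cpow_neg_mul_I (p : Nat.Primes) (u : ℝ) :
    ((p : ℕ) : ℂ) ^ (-(u * I)) = exp (((-(u * Real.log p) : ℝ) : ℂ) * I) := by
  have hp0 : ((p : ℕ) : ℂ) ≠ 0 := Nat.cast_ne_zero.2 p.prop.ne_zero
  rw [cpow_def_of_ne_zero hp0, ← natCast_log]
  congr 1
  push_cast
  ring

/-- `|p^{-it} − 1| = 2|sin(½ t log p)|` ("`= exp(2 Σ_p p^{-σ}|sin(½ t log p)|)`", proof of Lemma 2).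
[cite: MontgomeryVaughan2001, Lemma 2 (proof, (20))] -/
theorem norm_natCast_cpow_neg_mul_I_sub_one_eq (p : Nat.Primes) (t : ℝ) :
    ‖((p : ℕ) : ℂ) ^ (-(t * I)) - 1‖ = 2 * |Real.sin (t * Real.log p / 2)| := by
  rw [natCast_cpow_neg_mul_I, mul_comm _ I, Complex.norm_exp_I_mul_ofReal_sub_one, norm_mul,
    Real.norm_eq_abs, Real.norm_eq_abs, abs_two, neg_div, Real.sin_neg, abs_neg, mul_div_assoc]

/-! ## Prime sums `Σ_p p^{-σ} cos(u log p)` against `log|ζ(σ+iu)|` -/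

/-- `Re p^{-(σ+iu)} = p^{-σ} cos(u log p)`. [folklore] -/
theorem re_natCast_cpow_neg (p : Nat.Primes) (σ u : ℝ) :
    (((p : ℕ) : ℂ) ^ (-((σ : ℂ) + u * I))).re = ((p : ℕ) : ℝ) ^ (-σ) * Real.cos (u * Real.log p) := by
  have hp0 : (0 : ℝ) ≤ (p : ℕ) := Nat.cast_nonneg _
  have hpc : ((p : ℕ) : ℂ) ≠ 0 := Nat.cast_ne_zero.2 p.prop.ne_zero
  have e : ((p : ℕ) : ℂ) ^ (-((σ : ℂ) + u * I)) =
      ((((p : ℕ) : ℝ) ^ (-σ) : ℝ) : ℂ) * exp (((-(u * Real.log p) : ℝ) : ℂ) * I) := by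
    rw [neg_add, cpow_add _ _ hpc, natCast_cpow_neg_mul_I, ofReal_cpow hp0, ofReal_natCast]
    simp only [ofReal_neg]
  rw [e, re_ofReal_mul, exp_ofReal_mul_I_re, Real.cos_neg]

/-- `LSeries` of the trivial twist is `ζ` (complex `s`, `Re s > 1`). [folklore] -/
theorem LSeries_oneHom' {s : ℂ} (hs : 1 < s.re) :
    LSeries ((1 : ℕ →*₀ ℂ) ·) s = riemannZeta s := by
  rw [← LSeries_one_eq_riemannZeta hs]
  refine LSeries_congr (s := s) fun {n} hn ↦ ?_
  rw [MonoidWithZeroHom.one_apply_def, if_neg hn, Pi.one_apply]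

/-- `Σ_p p^{-σ} cos(u log p)` converges for `σ > 1`. [folklore] -/
theorem summable_primes_rpow_mul_cos {σ : ℝ} (hσ : 1 < σ) (u : ℝ) :
    Summable fun p : Nat.Primes ↦ ((p : ℕ) : ℝ) ^ (-σ) * Real.cos (u * Real.log p) := by
  refine Summable.of_norm_bounded (summable_primes_rpow_neg hσ) fun p ↦ ?_
  rw [Real.norm_eq_abs, abs_mul, abs_of_nonneg (Real.rpow_nonneg (Nat.cast_nonneg _) _)]
  exact mul_le_of_le_one_right (Real.rpow_nonneg (Nat.cast_nonneg _) _) (Real.abs_cos_le_one _)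

/-- **`|log|ζ(σ+iu)| − Σ_p p^{-σ}cos(u log p)| ≤ 2`** for `σ > 1` and real `u`: the Euler product
`|ζ(s)| = exp(Re Σ_p −log(1 − p^{-s}))` and the second-order terms `Σ_p 1/p² ≤ 2`
(the tree's `abs_re_tsum_neg_log_sub_re_tsum_le` for the trivial twist). This is the step
"`Σ_p p^{-σ-ikt} = log ζ(σ+ikt) + O(1)`" of the proof of Lemma 2.
[cite: MontgomeryVaughan2001, Lemma 2 (proof)] -/
theorem abs_log_norm_zeta_sub_cosSum_le {σ : ℝ} (hσ : 1 < σ) (u : ℝ) :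
    |Real.log ‖riemannZeta (σ + u * I)‖ -
        ∑' p : Nat.Primes, ((p : ℕ) : ℝ) ^ (-σ) * Real.cos (u * Real.log p)| ≤ 2 := by
  have hsre : ((σ : ℂ) + u * I).re = σ := by simp
  have hs1 : 1 < ((σ : ℂ) + u * I).re := by rw [hsre]; exact hσ
  have hs0 : ((σ : ℂ) + u * I) ≠ 0 := fun h ↦ by
    have := congrArg Complex.re h
    rw [hsre, zero_re] at this
    linarith
  set g : ℕ →*₀ ℂ := (1 : ℕ →*₀ ℂ) * riemannZetaSummandHom hs0 with hgdef
  have hg : ∀ n : ℕ, ‖g n‖ ≤ (n : ℝ) ^ (-σ) := fun n ↦ by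
    have := norm_mul_summandHom_le' (1 : ℕ →*₀ ℂ) norm_oneHom_le hs0 n
    rwa [hsre] at this
  obtain ⟨-, hG, hE⟩ := eulerPackage hσ g hg
  rw [tsum_mul_summandHom_eq_LSeries', LSeries_oneHom' hs1] at hE
  have hA := abs_re_tsum_neg_log_sub_re_tsum_le hσ g hg
  have hre : ∀ p : Nat.Primes, (g p).re = ((p : ℕ) : ℝ) ^ (-σ) * Real.cos (u * Real.log p) := by
    intro p
    rw [hgdef, mulHom_apply, MonoidWithZeroHom.one_apply_def, if_neg p.prop.ne_zero, one_mul]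
    exact re_natCast_cpow_neg p σ u
  have hsum : (∑' p : Nat.Primes, g p).re =
      ∑' p : Nat.Primes, ((p : ℕ) : ℝ) ^ (-σ) * Real.cos (u * Real.log p) := by
    rw [Complex.re_tsum hG]
    exact tsum_congr hre
  have hlog : Real.log ‖riemannZeta (σ + u * I)‖ = (∑' p : Nat.Primes, -log (1 - g p)).re := by
    rw [← hE, Real.log_exp]
  rw [hlog, ← hsum]
  exact hA.trans tsum_primes_one_div_sq_le_two

/-- The prime zeta sum `P(σ) = Σ_p p^{-σ} ≤ log(2/(σ−1)) + 2` for `1 < σ ≤ 2`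
(`|log ζ(σ) − P(σ)| ≤ 2` and `ζ(σ) ≤ 2/(σ−1)`). [cite: MontgomeryVaughan2001, Lemma 1 (proof)] -/
theorem primeZeta_le {σ : ℝ} (hσ : 1 < σ) (hσ2 : σ ≤ 2) :
    ∑' p : Nat.Primes, ((p : ℕ) : ℝ) ^ (-σ) ≤ Real.log (2 / (σ - 1)) + 2 := by
  have h := abs_log_norm_zeta_sub_cosSum_le hσ 0
  simp only [zero_mul, Real.cos_zero, mul_one, ofReal_zero, add_zero] at h
  have hz : Real.log ‖riemannZeta σ‖ ≤ Real.log (2 / (σ - 1)) :=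
    Real.log_le_log (lt_of_lt_of_le (by positivity) (norm_zeta_ofReal_ge hσ))
      (norm_zeta_ofReal_le hσ hσ2)
  have := (abs_le.1 h).1
  linarith

/-! ## `1/ζ(σ+iu)` for `σ > 1`: `≪ log(|u|+3)` and `≪ |σ − 1 + iu| log(|u|+3)` -/

/-- From the tree's classical-region bounds `‖1/ζ(s)‖ ≤ C log(|t|+3)` and
`‖ζ(s) − 1/(s−1)‖ ≤ C log(|t|+3)` (`ZetaClassicalRegion.exists_zeroFreeRegion_bounds`,
Titchmarsh (3.11.8), the input "`|ζ(σ+it)| ≥ 1/(C log t)`" quoted in the proof of Lemma 2): there is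
an absolute `B` with, for all `σ > 1` and real `u`,
`log|1/ζ(σ+iu)| ≤ log log(|u|+3) + B` and `log|1/ζ(σ+iu)| ≤ log((σ−1)+|u|) + log log(|u|+3) + B`
(the second because `|ζ(s)| ≥ 1/(2|s−1|)` when `|s−1| C log(|u|+3) ≤ 1/2`).
[cite: MontgomeryVaughan2001, Lemma 2 (proof)] -/
theorem exists_log_norm_inv_zeta_le :
    ∃ B : ℝ, ∀ σ u : ℝ, 1 < σ →
      Real.log ‖(riemannZeta (σ + u * I))⁻¹‖ ≤ Real.log (Real.log (|u| + 3)) + B ∧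
      Real.log ‖(riemannZeta (σ + u * I))⁻¹‖ ≤
        Real.log ((σ - 1) + |u|) + Real.log (Real.log (|u| + 3)) + B := by
  obtain ⟨cbar, hcb0, -, C, hC, hreg⟩ := ZetaClassicalRegion.exists_zeroFreeRegion_bounds
  refine ⟨2 * Real.log 2 + 2 * |Real.log C| + 1, fun σ u hσ ↦ ?_⟩
  set s : ℂ := σ + u * I with hsdef
  have hsre : s.re = σ := by simp [hsdef]
  have hsim : s.im = u := by simp [hsdef]
  have hs1 : s ≠ 1 := fun h ↦ by
    have := congrArg Complex.re h
    rw [hsre, one_re] at this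
    linarith
  set L : ℝ := Real.log (|u| + 3) with hLdef
  have hL1 : 1 < L := ZetaClassicalRegion.one_lt_log_abs_add_three u
  have hL0 : 0 < L := by linarith
  have hreg' := hreg s hs1 (by
    rw [hsre, hsim]
    have : 0 ≤ 4 * cbar / Real.log (|u| + 3) := by positivity
    linarith)
  rw [hsim] at hreg'
  obtain ⟨hζ, hsub, hinv, -⟩ := hreg'
  have hinvpos : 0 < ‖(riemannZeta s)⁻¹‖ := norm_pos_iff.2 (inv_ne_zero hζ)
  have hlogL : 0 < Real.log L := Real.log_pos hL1
  have h1 : Real.log ‖(riemannZeta s)⁻¹‖ ≤ Real.log C + Real.log L := by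
    rw [← Real.log_mul hC.ne' hL0.ne']
    exact Real.log_le_log hinvpos hinv
  have hlogC : Real.log C ≤ |Real.log C| := le_abs_self _
  have hlogC' : -Real.log C ≤ |Real.log C| := neg_le_abs _
  have hlog2 : 0 < Real.log 2 := Real.log_pos one_lt_two
  refine ⟨by linarith, ?_⟩
  -- the second bound
  set ρ : ℝ := (σ - 1) + |u| with hρdef
  have hρ0 : 0 < ρ := by positivity
  have hr : ‖s - 1‖ ≤ ρ := by
    have e : s - 1 = ((σ - 1 : ℝ) : ℂ) + (u : ℂ) * I := by rw [hsdef]; push_cast; ring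
    rw [e]
    refine (norm_add_le _ _).trans (le_of_eq ?_)
    rw [norm_real, Real.norm_eq_abs, abs_of_pos (by linarith), norm_mul, norm_real, norm_I, mul_one,
      Real.norm_eq_abs]
  have hrpos : 0 < ‖s - 1‖ := norm_pos_iff.2 (sub_ne_zero.2 hs1)
  rcases le_or_gt 1 |u| with hu | hu
  · -- `|u| ≥ 1`: `log ρ ≥ 0`
    have : 0 ≤ Real.log ρ := Real.log_nonneg (by linarith)
    linarith
  · -- `|u| < 1`: `L ≤ log 4 ≤ 2`, so `log L ≤ log 2`
    have hL4 : L ≤ 2 := by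
      calc L ≤ Real.log 4 := Real.log_le_log (by positivity) (by linarith)
        _ = 2 * Real.log 2 := by
            rw [show (4 : ℝ) = 2 ^ 2 by norm_num, Real.log_pow]; norm_num
        _ ≤ 2 := by have := Real.log_two_lt_d9; linarith
    have hlogL2 : Real.log L ≤ Real.log 2 := Real.log_le_log hL0 hL4
    have hA0 : 0 < C * L := mul_pos hC hL0
    rcases le_or_gt (‖s - 1‖ * (C * L)) (1 / 2) with hsmall | hbig
    · -- near the pole: `|ζ(s)| ≥ 1/|s−1| − C L ≥ 1/(2|s−1|)`
      have hAle : C * L ≤ 1 / (2 * ‖s - 1‖) := by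
        rw [le_div_iff₀ (by positivity)]; linarith
      have htri : ‖(1 : ℂ) / (s - 1)‖ - ‖riemannZeta s - 1 / (s - 1)‖ ≤ ‖riemannZeta s‖ := by
        have := norm_sub_norm_le ((1 : ℂ) / (s - 1)) ((1 : ℂ) / (s - 1) - riemannZeta s)
        rwa [sub_sub_cancel, norm_sub_rev ((1 : ℂ) / (s - 1))] at this
      have e1 : ‖(1 : ℂ) / (s - 1)‖ = 1 / ‖s - 1‖ := by rw [norm_div, norm_one]
      rw [e1] at htri
      have hhalf : 1 / ‖s - 1‖ - 1 / (2 * ‖s - 1‖) = 1 / (2 * ‖s - 1‖) := by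
        field_simp; ring
      have hz : 1 / (2 * ‖s - 1‖) ≤ ‖riemannZeta s‖ := by linarith
      have hinv2 : ‖(riemannZeta s)⁻¹‖ ≤ 2 * ρ := by
        rw [norm_inv]
        calc ‖riemannZeta s‖⁻¹ ≤ (1 / (2 * ‖s - 1‖))⁻¹ := by
              rw [inv_le_inv₀ (norm_pos_iff.2 hζ) (by positivity)]; exact hz
          _ = 2 * ‖s - 1‖ := by rw [one_div, inv_inv]
          _ ≤ 2 * ρ := by linarith
      have : Real.log ‖(riemannZeta s)⁻¹‖ ≤ Real.log 2 + Real.log ρ := by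
        rw [← Real.log_mul two_ne_zero hρ0.ne']
        exact Real.log_le_log hinvpos hinv2
      have : (0 : ℝ) ≤ |Real.log C| := abs_nonneg _
      linarith
    · -- away from the pole: `ρ ≥ |s−1| > 1/(2CL)`
      have hρA : 1 / (2 * (C * L)) < ρ := by
        refine lt_of_lt_of_le ?_ hr
        rw [div_lt_iff₀ (by positivity)]; linarith
      have hlogρ : -(Real.log 2 + Real.log C + Real.log L) < Real.log ρ := by
        have e : Real.log (1 / (2 * (C * L))) = -(Real.log 2 + Real.log C + Real.log L) := by
          rw [one_div, Real.log_inv, Real.log_mul two_ne_zero hA0.ne', Real.log_mul hC.ne' hL0.ne']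
          ring
        rw [← e]
        exact Real.log_lt_log (by positivity) hρA
      linarith

/-! ## The Fourier expansion of `Σ_p p^{-σ}|sin(½ t log p)|` -/

/-- The Fourier coefficients `a_m = 4/(π(4(m+1)² − 1))` (`m ≥ 0`) of `2/π − |sin|` are positive.
[folklore] -/
theorem absSinCoeff_pos (m : ℕ) : 0 < 4 / (Real.pi * (4 * ((m : ℝ) + 1) ^ 2 - 1)) := by
  simpa only [Nat.add_zero] using Literature.Analysis.Fourier.tail_coeff_pos 0 m

/-- … and summable. [folklore] -/
theorem summable_absSinCoeff : Summable fun m : ℕ ↦ 4 / (Real.pi * (4 * ((m : ℝ) + 1) ^ 2 - 1)) := by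
  simpa only [Nat.add_zero] using Literature.Analysis.Fourier.summable_tail_coeff 0

/-- … with sum `Σ_{m ≥ 0} a_m = 2/π` (the Fourier series of `|sin|` at `0`; equivalently
`Σ 1/(4k²−1) = 1/2`). [folklore] -/
theorem hasSum_absSinCoeff :
    HasSum (fun m : ℕ ↦ 4 / (Real.pi * (4 * ((m : ℝ) + 1) ^ 2 - 1))) (2 / Real.pi) := by
  have h := Literature.Analysis.Fourier.hasSum_abs_sin_nat 0
  simp only [mul_zero, Real.cos_zero, mul_one, Real.sin_zero, abs_zero, sub_zero] at h
  exact h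

/-- **Fourier expansion of the oscillating prime sum** (the device of the proof of Lemma 2 for
`|t| ≥ 2`, "the Fourier series of `|sin πθ|`"): for `σ > 1` and real `t`, with
`a_m = 4/(π(4(m+1)²−1))`,
`Σ_{m ≥ 0} a_m Σ_p p^{-σ} cos((m+1) t log p) = Σ_p p^{-σ} (2/π − |sin(½ t log p)|)`,
the double series converging absolutely (`|a_m p^{-σ} cos| ≤ a_m p^{-σ}`).
[cite: MontgomeryVaughan2001, Lemma 2 (proof)] -/
theorem hasSum_absSinCoeff_mul_cosSum {σ : ℝ} (hσ : 1 < σ) (t : ℝ) :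
    HasSum (fun m : ℕ ↦ 4 / (Real.pi * (4 * ((m : ℝ) + 1) ^ 2 - 1)) *
        ∑' p : Nat.Primes, ((p : ℕ) : ℝ) ^ (-σ) * Real.cos (((m : ℝ) + 1) * t * Real.log p))
      (∑' p : Nat.Primes, ((p : ℕ) : ℝ) ^ (-σ) * (2 / Real.pi - |Real.sin (t * Real.log p / 2)|)) := by
  set w : Nat.Primes → ℝ := fun p ↦ ((p : ℕ) : ℝ) ^ (-σ) with hw
  set a : ℕ → ℝ := fun m ↦ 4 / (Real.pi * (4 * ((m : ℝ) + 1) ^ 2 - 1)) with ha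
  have hw0 : ∀ p, 0 ≤ w p := fun p ↦ Real.rpow_nonneg (Nat.cast_nonneg _) _
  have hws : Summable w := summable_primes_rpow_neg hσ
  have ha0 : ∀ m, 0 < a m := absSinCoeff_pos
  have has : Summable a := summable_absSinCoeff
  -- the absolutely convergent double family
  set G : Nat.Primes × ℕ → ℝ :=
    fun x ↦ w x.1 * (a x.2 * Real.cos (((x.2 : ℝ) + 1) * t * Real.log x.1)) with hG
  have hGs : Summable G := by
    refine Summable.of_norm_bounded (hws.mul_of_nonneg has hw0 fun m ↦ (ha0 m).le) fun x ↦ ?_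
    rw [Real.norm_eq_abs, hG]
    dsimp only
    rw [abs_mul, abs_mul, abs_of_nonneg (hw0 _), abs_of_pos (ha0 _)]
    exact mul_le_mul_of_nonneg_left (mul_le_of_le_one_right (ha0 _).le (Real.abs_cos_le_one _))
      (hw0 _)
  -- fibres over `p`: the Fourier series of `|sin|` at `θ = ½ t log p`
  have hfib_p : ∀ p : Nat.Primes,
      HasSum (fun m ↦ G (p, m)) (w p * (2 / Real.pi - |Real.sin (t * Real.log p / 2)|)) := by
    intro p
    have h := (Literature.Analysis.Fourier.hasSum_abs_sin_nat (t * Real.log p / 2)).mul_left (w p)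
    refine h.congr_fun fun m ↦ ?_
    show w p * (a m * Real.cos (((m : ℝ) + 1) * t * Real.log p)) =
      w p * (4 / (Real.pi * (4 * ((m : ℝ) + 1) ^ 2 - 1)) * Real.cos (2 * ((m : ℝ) + 1) * (t * Real.log p / 2)))
    rw [ha]
    congr 3
    ring
  have hP : HasSum (fun p ↦ w p * (2 / Real.pi - |Real.sin (t * Real.log p / 2)|)) (∑' x, G x) :=
    hGs.hasSum.prod_fiberwise hfib_p
  -- fibres over `m`: `a_m Σ_p p^{-σ} cos((m+1) t log p)`
  have hGs' : HasSum (fun x : ℕ × Nat.Primes ↦ G (x.2, x.1)) (∑' x, G x) :=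
    (Equiv.prodComm ℕ Nat.Primes).hasSum_iff.2 hGs.hasSum
  have hfib_m : ∀ m : ℕ, HasSum (fun p ↦ G (p, m))
      (a m * ∑' p : Nat.Primes, w p * Real.cos (((m : ℝ) + 1) * t * Real.log p)) := by
    intro m
    have h := (summable_primes_rpow_mul_cos hσ (((m : ℝ) + 1) * t)).hasSum.mul_left (a m)
    refine h.congr_fun fun p ↦ ?_
    show w p * (a m * Real.cos (((m : ℝ) + 1) * t * Real.log p)) =
      a m * (((p : ℕ) : ℝ) ^ (-σ) * Real.cos (((m : ℝ) + 1) * t * Real.log p))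
    rw [hw]
    ring
  have hM := hGs'.prod_fiberwise hfib_m
  rwa [← hP.tsum_eq] at hM

/-- `Σ_p p^{-σ}|sin(½ t log p)|` converges for `σ > 1`. [folklore] -/
theorem summable_primes_rpow_mul_abs_sin {σ : ℝ} (hσ : 1 < σ) (t : ℝ) :
    Summable fun p : Nat.Primes ↦ ((p : ℕ) : ℝ) ^ (-σ) * |Real.sin (t * Real.log p / 2)| := by
  refine Summable.of_norm_bounded (summable_primes_rpow_neg hσ) fun p ↦ ?_
  rw [Real.norm_eq_abs, abs_mul, abs_abs, abs_of_nonneg (Real.rpow_nonneg (Nat.cast_nonneg _) _)]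
  exact mul_le_of_le_one_right (Real.rpow_nonneg (Nat.cast_nonneg _) _) (Real.abs_sin_le_one _)

/-- The expansion solved for the `|sin|`-sum:
`Σ_p p^{-σ}|sin(½ t log p)| = (2/π) P(σ) − Σ_m a_m Σ_p p^{-σ} cos((m+1) t log p)`.
[cite: MontgomeryVaughan2001, Lemma 2 (proof)] -/
theorem tsum_primes_rpow_mul_abs_sin_eq {σ : ℝ} (hσ : 1 < σ) (t : ℝ) :
    ∑' p : Nat.Primes, ((p : ℕ) : ℝ) ^ (-σ) * |Real.sin (t * Real.log p / 2)| =
      2 / Real.pi * ∑' p : Nat.Primes, ((p : ℕ) : ℝ) ^ (-σ) -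
        ∑' m : ℕ, 4 / (Real.pi * (4 * ((m : ℝ) + 1) ^ 2 - 1)) *
          ∑' p : Nat.Primes, ((p : ℕ) : ℝ) ^ (-σ) * Real.cos (((m : ℝ) + 1) * t * Real.log p) := by
  rw [(hasSum_absSinCoeff_mul_cosSum hσ t).tsum_eq]
  have h1 : ∀ p : Nat.Primes, ((p : ℕ) : ℝ) ^ (-σ) * (2 / Real.pi - |Real.sin (t * Real.log p / 2)|) =
      2 / Real.pi * ((p : ℕ) : ℝ) ^ (-σ) - ((p : ℕ) : ℝ) ^ (-σ) * |Real.sin (t * Real.log p / 2)| :=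
    fun p ↦ by ring
  rw [tsum_congr h1, ((summable_primes_rpow_neg hσ).mul_left _).tsum_sub
    (summable_primes_rpow_mul_abs_sin hσ t), tsum_mul_left]
  ring

/-! ## Bookkeeping in `m`: `Σ_m a_m log(m+1) < ∞` -/

/-- `a_m ≤ 1/(2(m+1)²)` (as `4(m+1)² − 1 ≥ 3(m+1)²` and `π > 3`). [folklore] -/
theorem absSinCoeff_le (m : ℕ) :
    4 / (Real.pi * (4 * ((m : ℝ) + 1) ^ 2 - 1)) ≤ 1 / (2 * ((m : ℝ) + 1) ^ 2) := by
  have hm : (1 : ℝ) ≤ ((m : ℝ) + 1) ^ 2 := by nlinarith [Nat.cast_nonneg (α := ℝ) m]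
  have hpos : 0 < 4 * ((m : ℝ) + 1) ^ 2 - 1 := by nlinarith
  rw [div_le_div_iff₀ (by positivity) (by positivity)]
  nlinarith [Real.pi_gt_three]

/-- `Σ_m a_m log(m+1)` converges (`a_m log(m+1) ≤ (m+1)^{-3/2}` by `log x ≤ 2√x`). [folklore] -/
theorem summable_absSinCoeff_mul_log :
    Summable fun m : ℕ ↦ 4 / (Real.pi * (4 * ((m : ℝ) + 1) ^ 2 - 1)) * Real.log ((m : ℝ) + 1) := by
  have hs : Summable fun m : ℕ ↦ ((((m + 1 : ℕ) : ℝ)) ^ (3 / 2 : ℝ))⁻¹ :=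
    (summable_nat_add_iff 1).2 (Real.summable_nat_rpow_inv.2 (by norm_num))
  refine Summable.of_nonneg_of_le (fun m ↦ ?_) (fun m ↦ ?_) hs
  · exact mul_nonneg (absSinCoeff_pos m).le (Real.log_nonneg (by simp))
  · have hx : (0 : ℝ) < (m : ℝ) + 1 := by positivity
    have hlog : Real.log ((m : ℝ) + 1) ≤ ((m : ℝ) + 1) ^ (1 / 2 : ℝ) / (1 / 2) :=
      Real.log_le_rpow_div hx.le one_half_pos
    have hx2 : ((m : ℝ) + 1) ^ 2 = ((m : ℝ) + 1) ^ (1 / 2 : ℝ) * ((m : ℝ) + 1) ^ (3 / 2 : ℝ) := by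
      rw [← Real.rpow_add hx, show (1 / 2 : ℝ) + 3 / 2 = 2 by norm_num, Real.rpow_two]
    have h32 : 0 < ((m : ℝ) + 1) ^ (3 / 2 : ℝ) := Real.rpow_pos_of_pos hx _
    have h12 : 0 < ((m : ℝ) + 1) ^ (1 / 2 : ℝ) := Real.rpow_pos_of_pos hx _
    push_cast
    calc 4 / (Real.pi * (4 * ((m : ℝ) + 1) ^ 2 - 1)) * Real.log ((m : ℝ) + 1)
        ≤ 1 / (2 * ((m : ℝ) + 1) ^ 2) * (((m : ℝ) + 1) ^ (1 / 2 : ℝ) / (1 / 2)) :=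
          mul_le_mul (absSinCoeff_le m) hlog (Real.log_nonneg (by simp)) (by positivity)
      _ = (((m : ℝ) + 1) ^ (3 / 2 : ℝ))⁻¹ := by
          rw [hx2]; field_simp

/-- Weighted summation of a termwise bound `c_m ≤ X + 2 log(m+1)` against the coefficients `a_m`:
`Σ_m a_m c_m ≤ (2/π) X + 2 Σ_m a_m log(m+1)` (`Σ a_m = 2/π`). [folklore] -/
theorem tsum_absSinCoeff_mul_le {c : ℕ → ℝ} {X : ℝ}
    (hc : Summable fun m : ℕ ↦ 4 / (Real.pi * (4 * ((m : ℝ) + 1) ^ 2 - 1)) * c m)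
    (h : ∀ m : ℕ, c m ≤ X + 2 * Real.log ((m : ℝ) + 1)) :
    ∑' m : ℕ, 4 / (Real.pi * (4 * ((m : ℝ) + 1) ^ 2 - 1)) * c m ≤
      2 / Real.pi * X +
        2 * ∑' m : ℕ, 4 / (Real.pi * (4 * ((m : ℝ) + 1) ^ 2 - 1)) * Real.log ((m : ℝ) + 1) := by
  have hs1 : Summable fun m : ℕ ↦ 4 / (Real.pi * (4 * ((m : ℝ) + 1) ^ 2 - 1)) * X :=
    summable_absSinCoeff.mul_right X
  have hs2 := summable_absSinCoeff_mul_log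
  calc ∑' m : ℕ, 4 / (Real.pi * (4 * ((m : ℝ) + 1) ^ 2 - 1)) * c m
      ≤ ∑' m : ℕ, (4 / (Real.pi * (4 * ((m : ℝ) + 1) ^ 2 - 1)) * X +
          2 * (4 / (Real.pi * (4 * ((m : ℝ) + 1) ^ 2 - 1)) * Real.log ((m : ℝ) + 1))) := by
        refine hc.tsum_le_tsum (fun m ↦ ?_) (hs1.add (hs2.mul_left 2))
        have := absSinCoeff_pos m
        nlinarith [h m]
    _ = 2 / Real.pi * X +
        2 * ∑' m : ℕ, 4 / (Real.pi * (4 * ((m : ℝ) + 1) ^ 2 - 1)) * Real.log ((m : ℝ) + 1) := by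
        rw [hs1.tsum_add (hs2.mul_left 2), tsum_mul_right, tsum_mul_left, hasSum_absSinCoeff.tsum_eq]

/-! ## Elementary logarithmic inequalities in `m` and `t` -/

/-- For `|t| ≥ 2`: `log log((m+1)|t| + 3) ≤ log log|t| + 2 log(m+1) + 2`. [folklore] -/
theorem log_log_le_of_two_le (m : ℕ) {t : ℝ} (ht : 2 ≤ |t|) :
    Real.log (Real.log (|((m : ℝ) + 1) * t| + 3)) ≤
      Real.log (Real.log |t|) + 2 * Real.log ((m : ℝ) + 1) + 2 := by
  have hm0 : (0 : ℝ) ≤ (m : ℝ) := Nat.cast_nonneg m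
  have habs : |((m : ℝ) + 1) * t| = ((m : ℝ) + 1) * |t| := by
    rw [abs_mul, abs_of_pos (by linarith)]
  have hl2 : (1 / 2 : ℝ) < Real.log 2 := by have := Real.log_two_gt_d9; linarith
  have hx : Real.log 2 ≤ Real.log |t| := Real.log_le_log two_pos ht
  have hx0 : 0 < Real.log |t| := by linarith
  have hD0 : 0 ≤ Real.log ((m : ℝ) + 1) := Real.log_nonneg (by linarith)
  have h52 : Real.log (5 / 2) ≤ 1 := by
    rw [Real.log_le_iff_le_exp (by norm_num)]
    have := Real.exp_one_gt_d9
    linarith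
  -- step 1: `log((m+1)|t|+3) ≤ log|t| + log(m+1) + 1`
  have h1 : Real.log (((m : ℝ) + 1) * |t| + 3) ≤ Real.log |t| + (Real.log ((m : ℝ) + 1) + 1) := by
    have hle : ((m : ℝ) + 1) * |t| + 3 ≤ 5 / 2 * ((m : ℝ) + 1) * |t| := by nlinarith
    calc Real.log (((m : ℝ) + 1) * |t| + 3) ≤ Real.log (5 / 2 * ((m : ℝ) + 1) * |t|) :=
          Real.log_le_log (by positivity) hle
      _ = Real.log (5 / 2) + Real.log ((m : ℝ) + 1) + Real.log |t| := by
          rw [Real.log_mul (by positivity) (by positivity), Real.log_mul (by positivity) (by positivity)]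
      _ ≤ _ := by linarith
  -- step 2: `log(x + D) ≤ log x + 2D` for `x ≥ log 2 > 1/2`, `D ≥ 0`
  have h2 : Real.log (Real.log |t| + (Real.log ((m : ℝ) + 1) + 1)) ≤
      Real.log (Real.log |t|) + 2 * (Real.log ((m : ℝ) + 1) + 1) := by
    have hxD : Real.log |t| + (Real.log ((m : ℝ) + 1) + 1) ≤
        Real.log |t| * (1 + 2 * (Real.log ((m : ℝ) + 1) + 1)) := by nlinarith
    calc _ ≤ Real.log (Real.log |t| * (1 + 2 * (Real.log ((m : ℝ) + 1) + 1))) :=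
          Real.log_le_log (by positivity) hxD
      _ = Real.log (Real.log |t|) + Real.log (1 + 2 * (Real.log ((m : ℝ) + 1) + 1)) :=
          Real.log_mul hx0.ne' (by positivity)
      _ ≤ _ := by
          have := Real.log_le_sub_one_of_pos (by positivity : (0 : ℝ) < 1 + 2 * (Real.log ((m : ℝ) + 1) + 1))
          linarith
  have hpos1 : 0 < Real.log (((m : ℝ) + 1) * |t| + 3) := Real.log_pos (by nlinarith [abs_nonneg t])
  calc Real.log (Real.log (|((m : ℝ) + 1) * t| + 3))
      = Real.log (Real.log (((m : ℝ) + 1) * |t| + 3)) := by rw [habs]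
    _ ≤ Real.log (Real.log |t| + (Real.log ((m : ℝ) + 1) + 1)) := Real.log_le_log hpos1 h1
    _ ≤ _ := by linarith

/-- For `|t| ≤ 2`: `log log((m+1)|t| + 3) ≤ log(m+1) + 1`. [folklore] -/
theorem log_log_le_of_le_two (m : ℕ) {t : ℝ} (ht : |t| ≤ 2) :
    Real.log (Real.log (|((m : ℝ) + 1) * t| + 3)) ≤ Real.log ((m : ℝ) + 1) + 1 := by
  have hm0 : (0 : ℝ) ≤ (m : ℝ) := Nat.cast_nonneg m
  have habs : |((m : ℝ) + 1) * t| = ((m : ℝ) + 1) * |t| := by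
    rw [abs_mul, abs_of_pos (by linarith)]
  have h5 : Real.log 5 ≤ 2 := by
    rw [Real.log_le_iff_le_exp (by norm_num)]
    have h := Real.exp_one_gt_d9
    have : Real.exp 2 = Real.exp 1 * Real.exp 1 := by rw [← Real.exp_add]; norm_num
    nlinarith
  have hy0 : 0 < Real.log (|((m : ℝ) + 1) * t| + 3) := Real.log_pos (by linarith [abs_nonneg (((m : ℝ) + 1) * t)])
  have h1 : Real.log (|((m : ℝ) + 1) * t| + 3) ≤ 2 + Real.log ((m : ℝ) + 1) := by
    have hle : |((m : ℝ) + 1) * t| + 3 ≤ 5 * ((m : ℝ) + 1) := by rw [habs]; nlinarith [abs_nonneg t]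
    calc Real.log (|((m : ℝ) + 1) * t| + 3) ≤ Real.log (5 * ((m : ℝ) + 1)) :=
          Real.log_le_log (by positivity) hle
      _ = Real.log 5 + Real.log ((m : ℝ) + 1) := Real.log_mul (by norm_num) (by positivity)
      _ ≤ _ := by linarith
  have := Real.log_le_sub_one_of_pos hy0
  linarith

/-- For `σ − 1 ≤ |t|`: `log((σ−1) + (m+1)|t|) ≤ log(m+1) + log 2 + log|t|`. [folklore] -/
theorem log_shift_le (m : ℕ) {σ t : ℝ} (hσ : 1 < σ) (hst : σ - 1 ≤ |t|) :
    Real.log ((σ - 1) + |((m : ℝ) + 1) * t|) ≤ Real.log ((m : ℝ) + 1) + Real.log 2 + Real.log |t| := by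
  have hm0 : (0 : ℝ) ≤ (m : ℝ) := Nat.cast_nonneg m
  have ht0 : 0 < |t| := by linarith
  have habs : |((m : ℝ) + 1) * t| = ((m : ℝ) + 1) * |t| := by
    rw [abs_mul, abs_of_pos (by linarith)]
  have hle : (σ - 1) + |((m : ℝ) + 1) * t| ≤ ((m : ℝ) + 1) * 2 * |t| := by rw [habs]; nlinarith
  calc Real.log ((σ - 1) + |((m : ℝ) + 1) * t|) ≤ Real.log (((m : ℝ) + 1) * 2 * |t|) :=
        Real.log_le_log (by positivity) hle
    _ = _ := by rw [Real.log_mul (by positivity) ht0.ne', Real.log_mul (by positivity) two_ne_zero]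

/-! ## The `|sin|`-sum bounds in the two ranges of Lemma 2 -/

/-- Skeleton of both ranges: if `−Σ_p p^{-σ}cos((m+1)t log p) ≤ X + 2 log(m+1)` for every `m`, then
`Σ_p p^{-σ}|sin(½ t log p)| ≤ (2/π)(log 2 − log(σ−1) + 2) + (2/π) X + 2 Σ_m a_m log(m+1)`
(`1 < σ ≤ 2`). [cite: MontgomeryVaughan2001, Lemma 2 (proof)] -/
theorem tsum_abs_sin_le_of_termwise {σ t X : ℝ} (hσ : 1 < σ) (hσ2 : σ ≤ 2)
    (h : ∀ m : ℕ, -(∑' p : Nat.Primes, ((p : ℕ) : ℝ) ^ (-σ) * Real.cos (((m : ℝ) + 1) * t * Real.log p)) ≤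
      X + 2 * Real.log ((m : ℝ) + 1)) :
    ∑' p : Nat.Primes, ((p : ℕ) : ℝ) ^ (-σ) * |Real.sin (t * Real.log p / 2)| ≤
      2 / Real.pi * (Real.log 2 - Real.log (σ - 1) + 2) + 2 / Real.pi * X +
        2 * ∑' m : ℕ, 4 / (Real.pi * (4 * ((m : ℝ) + 1) ^ 2 - 1)) * Real.log ((m : ℝ) + 1) := by
  rw [tsum_primes_rpow_mul_abs_sin_eq hσ t]
  have hP := primeZeta_le hσ hσ2
  rw [Real.log_div two_ne_zero (by linarith)] at hP
  have hsum : Summable fun m : ℕ ↦ 4 / (Real.pi * (4 * ((m : ℝ) + 1) ^ 2 - 1)) *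
      -(∑' p : Nat.Primes, ((p : ℕ) : ℝ) ^ (-σ) * Real.cos (((m : ℝ) + 1) * t * Real.log p)) :=
    (hasSum_absSinCoeff_mul_cosSum hσ t).summable.neg.congr fun m ↦ by ring
  have hW := tsum_absSinCoeff_mul_le hsum h
  have hneg : ∑' m : ℕ, 4 / (Real.pi * (4 * ((m : ℝ) + 1) ^ 2 - 1)) *
        -(∑' p : Nat.Primes, ((p : ℕ) : ℝ) ^ (-σ) * Real.cos (((m : ℝ) + 1) * t * Real.log p)) =
      -(∑' m : ℕ, 4 / (Real.pi * (4 * ((m : ℝ) + 1) ^ 2 - 1)) *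
        ∑' p : Nat.Primes, ((p : ℕ) : ℝ) ^ (-σ) * Real.cos (((m : ℝ) + 1) * t * Real.log p)) := by
    rw [← tsum_neg]; exact tsum_congr fun m ↦ by ring
  rw [hneg] at hW
  have hπ : 0 < 2 / Real.pi := by positivity
  have hP' := mul_le_mul_of_nonneg_left hP hπ.le
  linarith

/-- **The range `|t| ≥ 2`**: `Σ_p p^{-σ}|sin(½ t log p)| ≤ (2/π) log(log|t|/(σ−1)) + O(1)`
("If `1 < σ ≤ 2` and `|t| ≥ 2` then `F(σ+it)/F(σ) ≪ (log|t|/(σ−1))^{4/π}`", via the Fourier series of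
`|sin|`, `Σ_p p^{-s} = log ζ(s) + O(1)` and `1/ζ(σ+it) ≪ log|t|`).
[cite: MontgomeryVaughan2001, Lemma 2 (proof)] -/
theorem tsum_abs_sin_le_of_two_le {B : ℝ}
    (hB : ∀ σ u : ℝ, 1 < σ →
      Real.log ‖(riemannZeta (σ + u * I))⁻¹‖ ≤ Real.log (Real.log (|u| + 3)) + B ∧
      Real.log ‖(riemannZeta (σ + u * I))⁻¹‖ ≤
        Real.log ((σ - 1) + |u|) + Real.log (Real.log (|u| + 3)) + B)
    {σ t : ℝ} (hσ : 1 < σ) (hσ2 : σ ≤ 2) (ht : 2 ≤ |t|) :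
    ∑' p : Nat.Primes, ((p : ℕ) : ℝ) ^ (-σ) * |Real.sin (t * Real.log p / 2)| ≤
      2 / Real.pi * (Real.log (Real.log |t|) - Real.log (σ - 1)) +
        (2 / Real.pi * (Real.log 2 + 6 + B) +
          2 * ∑' m : ℕ, 4 / (Real.pi * (4 * ((m : ℝ) + 1) ^ 2 - 1)) * Real.log ((m : ℝ) + 1)) := by
  have key : ∀ m : ℕ,
      -(∑' p : Nat.Primes, ((p : ℕ) : ℝ) ^ (-σ) * Real.cos (((m : ℝ) + 1) * t * Real.log p)) ≤
        (4 + B + Real.log (Real.log |t|)) + 2 * Real.log ((m : ℝ) + 1) := by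
    intro m
    have h2 := (abs_le.1 (abs_log_norm_zeta_sub_cosSum_le hσ (((m : ℝ) + 1) * t))).2
    have hz := (hB σ (((m : ℝ) + 1) * t) hσ).1
    have hll := log_log_le_of_two_le m ht
    have e : Real.log ‖(riemannZeta (σ + (((m : ℝ) + 1) * t : ℝ) * I))⁻¹‖ =
        -Real.log ‖riemannZeta (σ + (((m : ℝ) + 1) * t : ℝ) * I)‖ := by
      rw [norm_inv, Real.log_inv]
    push_cast at h2 hz e
    linarith
  have := tsum_abs_sin_le_of_termwise hσ hσ2 key
  linarith

/-- **The range `σ − 1 ≤ |t| ≤ 2`**: `Σ_p p^{-σ}|sin(½ t log p)| ≤ (2/π) log(|t|/(σ−1)) + O(1)`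
("If `1 < σ ≤ 2` and `|t| ≤ 2` then `F(σ+it)/F(σ) ≪ (1 + |t|/(σ−1))^{4/π}`"; here by the same Fourier
expansion with `|ζ(σ+iu)| ≫ 1/|σ−1+iu|` near the pole). [cite: MontgomeryVaughan2001, Lemma 2 (proof)] -/
theorem tsum_abs_sin_le_of_le_two {B : ℝ}
    (hB : ∀ σ u : ℝ, 1 < σ →
      Real.log ‖(riemannZeta (σ + u * I))⁻¹‖ ≤ Real.log (Real.log (|u| + 3)) + B ∧
      Real.log ‖(riemannZeta (σ + u * I))⁻¹‖ ≤
        Real.log ((σ - 1) + |u|) + Real.log (Real.log (|u| + 3)) + B)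
    {σ t : ℝ} (hσ : 1 < σ) (hσ2 : σ ≤ 2) (hst : σ - 1 ≤ |t|) (ht : |t| ≤ 2) :
    ∑' p : Nat.Primes, ((p : ℕ) : ℝ) ^ (-σ) * |Real.sin (t * Real.log p / 2)| ≤
      2 / Real.pi * (Real.log |t| - Real.log (σ - 1)) +
        (2 / Real.pi * (2 * Real.log 2 + 5 + B) +
          2 * ∑' m : ℕ, 4 / (Real.pi * (4 * ((m : ℝ) + 1) ^ 2 - 1)) * Real.log ((m : ℝ) + 1)) := by
  have key : ∀ m : ℕ,
      -(∑' p : Nat.Primes, ((p : ℕ) : ℝ) ^ (-σ) * Real.cos (((m : ℝ) + 1) * t * Real.log p)) ≤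
        (3 + Real.log 2 + B + Real.log |t|) + 2 * Real.log ((m : ℝ) + 1) := by
    intro m
    have h2 := (abs_le.1 (abs_log_norm_zeta_sub_cosSum_le hσ (((m : ℝ) + 1) * t))).2
    have hz := (hB σ (((m : ℝ) + 1) * t) hσ).2
    have hls := log_shift_le m hσ hst
    have hll := log_log_le_of_le_two m ht
    have e : Real.log ‖(riemannZeta (σ + (((m : ℝ) + 1) * t : ℝ) * I))⁻¹‖ =
        -Real.log ‖riemannZeta (σ + (((m : ℝ) + 1) * t : ℝ) * I)‖ := by
      rw [norm_inv, Real.log_inv]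
    push_cast at h2 hz e
    linarith
  have := tsum_abs_sin_le_of_termwise hσ hσ2 key
  linarith

/-- `Σ_p p^{-σ}|p^{-it} − 1| = 2 Σ_p p^{-σ}|sin(½ t log p)|` (the exponent in (20)).
[cite: MontgomeryVaughan2001, Lemma 2 (proof, (20))] -/
theorem tsum_twist_eq (σ t : ℝ) :
    ∑' p : Nat.Primes, ((p : ℕ) : ℝ) ^ (-σ) * ‖((p : ℕ) : ℂ) ^ (-(t * I)) - 1‖ =
      2 * ∑' p : Nat.Primes, ((p : ℕ) : ℝ) ^ (-σ) * |Real.sin (t * Real.log p / 2)| := by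
  rw [← tsum_mul_left]
  exact tsum_congr fun p ↦ by rw [norm_natCast_cpow_neg_mul_I_sub_one_eq]; ring

end MontgomeryVaughan2001

/-! ## Lemma 2 -/

/-- **Montgomery–Vaughan 2001, Lemma 2 — proved** (discharge of `MontgomeryVaughan2001_lemma2`).
"Let `f(n)` and `F(s)` be as in the preceding lemma. If `1 < σ ≤ 2` and `|t| ≤ 2` then
`F(σ + it)/F(σ) ≪ (1 + |t|/(σ − 1))^{4/π}`. If `1 < σ ≤ 2` and `|t| ≥ 2` then
`F(σ + it)/F(σ) ≪ (log|t|/(σ − 1))^{4/π}`."  Proof as formalised: by (20)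
(`MontgomeryVaughan2001.norm_LSeries_shift_le`) `|F(σ+it)| ≤ e⁴ exp(2Σ_p p^{-σ}|sin(½ t log p)|)|F(σ)|`;
expanding `|sin|` in its (absolutely convergent) Fourier series,
`Σ_p p^{-σ}|sin(½t log p)| = (2/π)P(σ) − Σ_{m≥1} (4/(π(4m²−1))) Re P(σ + imt)` with
`P(s) = Σ_p p^{-s} = log ζ(s) + O(1)`; `P(σ) ≤ log(1/(σ−1)) + O(1)`,
`−log|ζ(σ+iu)| ≤ log log(|u|+3) + O(1)` (and `≤ log|σ−1+iu| + log log(|u|+3) + O(1)` near the pole),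
and `Σ_{m≥1} 4/(π(4m²−1)) = 2/π` give `≤ (2/π) log(log|t|/(σ−1)) + O(1)` for `|t| ≥ 2` and
`≤ (2/π) log(|t|/(σ−1)) + O(1)` for `σ − 1 ≤ |t| ≤ 2`; the range `|t| ≤ σ − 1` is
`MontgomeryVaughan2001.exists_norm_LSeries_shift_le_of_abs_le`. The source handles `|t| ≤ 2` by
Mertens' theorem and partial summation against `|sin|` instead; the constant `4/π = 2·(2/π)` is twice
the mean value of `|sin|` either way. [cite: MontgomeryVaughan2001, Lemma 2] -/
theorem MontgomeryVaughan2001_lemma2_holds : MontgomeryVaughan2001_lemma2 := by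
  obtain ⟨B, hB⟩ := MontgomeryVaughan2001.exists_log_norm_inv_zeta_le
  obtain ⟨C₀, hC₀, h0⟩ := MontgomeryVaughan2001.exists_norm_LSeries_shift_le_of_abs_le
  set Λ : ℝ := ∑' m : ℕ, 4 / (Real.pi * (4 * ((m : ℝ) + 1) ^ 2 - 1)) * Real.log ((m : ℝ) + 1)
    with hΛ
  set K₁ : ℝ := 2 / Real.pi * (Real.log 2 + 6 + B) + 2 * Λ with hK₁
  set K₂ : ℝ := 2 / Real.pi * (2 * Real.log 2 + 5 + B) + 2 * Λ with hK₂
  set C : ℝ := max C₀ (max (Real.exp (4 + 2 * K₁)) (Real.exp (4 + 2 * K₂))) with hC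
  have hC1 : C₀ ≤ C := le_max_left _ _
  have hC2 : Real.exp (4 + 2 * K₁) ≤ C := (le_max_left _ _).trans (le_max_right _ _)
  have hC3 : Real.exp (4 + 2 * K₂) ≤ C := (le_max_right _ _).trans (le_max_right _ _)
  have hCpos : 0 < C := lt_of_lt_of_le hC₀ hC1
  refine ⟨C, hCpos, fun f hf σ t hσ hσ2 ↦ ⟨fun ht ↦ ?_, fun ht ↦ ?_⟩⟩
  · -- `|t| ≤ 2`
    have hσ1 : 0 < σ - 1 := by linarith
    have hF := norm_nonneg (LSeries (f ·) σ)
    rcases le_or_gt |t| (σ - 1) with hts | hts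
    · -- `|t| ≤ σ − 1`: `|F(σ+it)| ≤ C₀ |F(σ)|`
      have h := (h0 f hf σ t hσ hσ2 hts).1
      have hr : 1 ≤ (1 + |t| / (σ - 1)) ^ (4 / Real.pi) :=
        Real.one_le_rpow (le_add_of_nonneg_right (by positivity)) (by positivity)
      calc ‖LSeries (f ·) (σ + t * I)‖ ≤ C₀ * ‖LSeries (f ·) σ‖ := h
        _ ≤ C * (1 + |t| / (σ - 1)) ^ (4 / Real.pi) * ‖LSeries (f ·) σ‖ := by
            apply mul_le_mul_of_nonneg_right _ hF
            calc C₀ = C₀ * 1 := (mul_one _).symm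
              _ ≤ C * (1 + |t| / (σ - 1)) ^ (4 / Real.pi) := mul_le_mul hC1 hr zero_le_one hCpos.le
    · -- `σ − 1 < |t| ≤ 2`
      have hS := MontgomeryVaughan2001.tsum_abs_sin_le_of_le_two hB hσ hσ2 hts.le ht
      have h1 := (MontgomeryVaughan2001.norm_LSeries_shift_le f hf hσ t).1
      rw [MontgomeryVaughan2001.tsum_twist_eq σ t] at h1
      have ht0 : 0 < |t| := by linarith
      have hx : 0 < |t| / (σ - 1) := by positivity
      have hexp : Real.exp (2 * ∑' p : Nat.Primes, ((p : ℕ) : ℝ) ^ (-σ) * |Real.sin (t * Real.log p / 2)|)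
          ≤ Real.exp (2 * K₂) * (|t| / (σ - 1)) ^ (4 / Real.pi) := by
        rw [Real.rpow_def_of_pos hx, ← Real.exp_add, Real.exp_le_exp]
        have e : Real.log (|t| / (σ - 1)) * (4 / Real.pi) =
            2 * (2 / Real.pi * (Real.log |t| - Real.log (σ - 1))) := by
          rw [Real.log_div ht0.ne' hσ1.ne']; ring
        rw [e]
        linarith
      calc ‖LSeries (f ·) (σ + t * I)‖
          ≤ Real.exp 4 * Real.exp (2 * ∑' p : Nat.Primes,
              ((p : ℕ) : ℝ) ^ (-σ) * |Real.sin (t * Real.log p / 2)|) * ‖LSeries (f ·) σ‖ := h1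
        _ ≤ Real.exp 4 * (Real.exp (2 * K₂) * (|t| / (σ - 1)) ^ (4 / Real.pi)) * ‖LSeries (f ·) σ‖ :=
            mul_le_mul_of_nonneg_right (mul_le_mul_of_nonneg_left hexp (Real.exp_pos 4).le) hF
        _ = Real.exp (4 + 2 * K₂) * (|t| / (σ - 1)) ^ (4 / Real.pi) * ‖LSeries (f ·) σ‖ := by
            rw [Real.exp_add]; ring
        _ ≤ C * (1 + |t| / (σ - 1)) ^ (4 / Real.pi) * ‖LSeries (f ·) σ‖ := by
            apply mul_le_mul_of_nonneg_right _ hF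
            exact mul_le_mul hC3 (Real.rpow_le_rpow hx.le (by linarith) (by positivity))
              (by positivity) hCpos.le
  · -- `|t| ≥ 2`
    have hσ1 : 0 < σ - 1 := by linarith
    have hF := norm_nonneg (LSeries (f ·) σ)
    have hS := MontgomeryVaughan2001.tsum_abs_sin_le_of_two_le hB hσ hσ2 ht
    have h1 := (MontgomeryVaughan2001.norm_LSeries_shift_le f hf hσ t).1
    rw [MontgomeryVaughan2001.tsum_twist_eq σ t] at h1
    have hlt : 0 < Real.log |t| := Real.log_pos (by linarith)
    have hx : 0 < Real.log |t| / (σ - 1) := by positivity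
    have hexp : Real.exp (2 * ∑' p : Nat.Primes, ((p : ℕ) : ℝ) ^ (-σ) * |Real.sin (t * Real.log p / 2)|)
        ≤ Real.exp (2 * K₁) * (Real.log |t| / (σ - 1)) ^ (4 / Real.pi) := by
      rw [Real.rpow_def_of_pos hx, ← Real.exp_add, Real.exp_le_exp]
      have e : Real.log (Real.log |t| / (σ - 1)) * (4 / Real.pi) =
          2 * (2 / Real.pi * (Real.log (Real.log |t|) - Real.log (σ - 1))) := by
        rw [Real.log_div hlt.ne' hσ1.ne']; ring
      rw [e]
      linarith
    calc ‖LSeries (f ·) (σ + t * I)‖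
        ≤ Real.exp 4 * Real.exp (2 * ∑' p : Nat.Primes,
            ((p : ℕ) : ℝ) ^ (-σ) * |Real.sin (t * Real.log p / 2)|) * ‖LSeries (f ·) σ‖ := h1
      _ ≤ Real.exp 4 * (Real.exp (2 * K₁) * (Real.log |t| / (σ - 1)) ^ (4 / Real.pi)) *
            ‖LSeries (f ·) σ‖ :=
          mul_le_mul_of_nonneg_right (mul_le_mul_of_nonneg_left hexp (Real.exp_pos 4).le) hF
      _ = Real.exp (4 + 2 * K₁) * (Real.log |t| / (σ - 1)) ^ (4 / Real.pi) * ‖LSeries (f ·) σ‖ := by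
          rw [Real.exp_add]; ring
      _ ≤ C * (Real.log |t| / (σ - 1)) ^ (4 / Real.pi) * ‖LSeries (f ·) σ‖ := by
          apply mul_le_mul_of_nonneg_right _ hF
          exact mul_le_mul_of_nonneg_right hC2 (by positivity)

end Literature.NumberTheory.LFunctions
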